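import Mathlib.Analysis.Calculus.Deriv.Comp
import Mathlib.Analysis.Calculus.Deriv.Prod
import Mathlib.Analysis.Calculus.FDeriv.Prod
import Mathlib.Analysis.Calculus.ContDiff.Comp
import HarnessLib

/-!
# Transport of a profile by the inverse of a flow (Alberti–Crippa–Mazzucato 2019, §7, opening remark)

Topic `Literature/Analysis/FluidPDE`. Alberti–Crippa–Mazzucato, JAMS 32 (2019), §7, open the
construction of their building blocks with the "simple remark" (arXiv:1605.02090, p. 22): if
`Φ(t, ·)` is a (sufficiently smooth) flow of diffeomorphisms, then the Eulerian velocity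
`w(t, x) := ∂ₜΦ(t, z)` with `x = Φ(t, z)` is of class `C^{k-1}`, and for any profile `ρ̄` the
transported function `ρ(t, x) := ρ̄(z)`, `x = Φ(t, z)`, solves the transport equation
`∂ₜρ + w·∇ρ = 0` ("It is then well-known that …"; the divergence-free half of the remark needs
`JΦ = 1` and is not treated here).

This file proves the transport half in the form needed when the inverse `Y_t = Φ(t,·)⁻¹` is
known EXPLICITLY (the situation of explicit composite isotopies: shears, squeezes, twists), over
any real normed space and pointwise:

* `InverseFlow.apply_one_velocity_eq_zero`: if `Y_s (X_s z) = z` along the trajectory of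
  `z = Y_t x` and `X_t (Y_t x) = x`, then the derivative `L = D(Y)(t,x)` of `(s,x) ↦ Y_s x`
  kills the space–time velocity `(1, Ẋ_t z)`;
* `InverseFlow.hasDerivAt_inverse`: `∂ₜ Y_t(x) = -D_x Y_t(x)[Ẋ_t(Y_t x)]`;
* `InverseFlow.deriv_comp_add_fderiv_comp_apply_eq_zero`: for a differentiable profile `F`,
  `∂ₜ (F ∘ Y_t)(x) + D(F ∘ Y_t)(x)[V(t,x)] = 0` with `V(t,x) = Ẋ_t(Y_t x)` — the transport
  equation, in the `deriv`/`fderiv` shape used by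
  `Literature.Analysis.FluidPDE.QuasiSelfSimilar.IsBuildingBlockFamily.transport`;
* the packaged global version `InverseFlow.IsInversePair.transport` for a pair `(X, Y)` of
  mutually inverse time-dependent maps with `Y` jointly differentiable and differentiable
  trajectories `s ↦ X_s z`, the Eulerian velocity `InverseFlow.eulerVelocity X Y`, its Lagrangian
  reading `eulerVelocity X Y t (X t z) = ∂ₜ X_t z`, its expression through `D(X)` and its joint
  smoothness when `X`, `Y` are jointly smooth (`InverseFlow.contDiff_eulerVelocity`).

No measure theory, no divergence: the Jacobian/divergence-free half of ACM's remark and their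
Prop. 21 (cut-off of the stream function) are separate bricks.

## References

* G. Alberti, G. Crippa, A. L. Mazzucato, *Exponential self-similar mixing by incompressible
  flows*, J. Amer. Math. Soc. 32 (2019), 445–490, §7, remark before Prop. 21 (arXiv:1605.02090,
  p. 22).
-/

noncomputable section

open Function
open scoped ContDiff

namespace Literature.Analysis.FluidPDE

namespace InverseFlow

variable {E : Type*} [NormedAddCommGroup E] [NormedSpace ℝ E]
  {G : Type*} [NormedAddCommGroup G] [NormedSpace ℝ G]

/-! ## Pointwise identities -/

section Pointwise

variable {X Y : ℝ → E → E} {t : ℝ} {x : E} {L : ℝ × E →L[ℝ] E} {v : E}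

/-- **The derivative of the inverse kills the space–time velocity.** If `X_t (Y_t x) = x`,
`Y_s (X_s z) = z` for the point `z = Y_t x` and all `s`, `(s, x) ↦ Y_s x` has derivative `L` at
`(t, x)` and the trajectory `s ↦ X_s z` has velocity `v` at `s = t`, then `L (1, v) = 0`
(differentiate the constant `s ↦ Y_s (X_s z)`; ACM 2019, §7: `ρ̄ ∘ Φ⁻¹` is transported).
[cite: AlbertiCrippaMazzucato2019, §7 (remark before Prop. 21)] -/
theorem apply_one_velocity_eq_zero (hXY : X t (Y t x) = x) (hYX : ∀ s, Y s (X s (Y t x)) = Y t x)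
    (hY : HasFDerivAt (uncurry Y) L (t, x)) (hX : HasDerivAt (fun s => X s (Y t x)) v t) :
    L (1, v) = 0 := by
  -- the curve `s ↦ (s, X_s z)` passes through `(t, x)` at `s = t` with velocity `(1, v)`
  have hγ : HasDerivAt (fun s => (s, X s (Y t x))) (1, v) t := (hasDerivAt_id t).prodMk hX
  have hY' : HasFDerivAt (uncurry Y) L ((fun s => (s, X s (Y t x))) t) := by
    simpa only [hXY] using hY
  have hcomp : HasDerivAt (uncurry Y ∘ fun s => (s, X s (Y t x))) (L (1, v)) t :=
    hY'.comp_hasDerivAt t hγ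
  -- but the composite is the constant `z = Y_t x`
  have hconst : HasDerivAt (uncurry Y ∘ fun s => (s, X s (Y t x))) 0 t := by
    have h : (uncurry Y ∘ fun s => (s, X s (Y t x))) = fun _ => Y t x := by
      funext s
      exact hYX s
    rw [h]
    exact hasDerivAt_const t (Y t x)
  exact hcomp.unique hconst

/-- The time derivative of `s ↦ Y_s x` is the value of the space–time derivative on `(1, 0)`.
[folklore] -/
theorem hasDerivAt_inverse_apply_one_zero (hY : HasFDerivAt (uncurry Y) L (t, x)) :
    HasDerivAt (fun s => Y s x) (L (1, 0)) t := by
  have hι : HasDerivAt (fun s : ℝ => (s, x)) (1, 0) t := (hasDerivAt_id t).prodMk (hasDerivAt_const t x)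
  exact hY.comp_hasDerivAt t hι

/-- **Time derivative of the inverse of a flow**: `∂ₜ Y_t (x) = -D_x Y_t(x) [Ẋ_t (Y_t x)]`, the
space derivative being read off the space–time derivative `L` as `w ↦ L (0, w)` (ACM 2019, §7).
[cite: AlbertiCrippaMazzucato2019, §7 (remark before Prop. 21)] -/
theorem hasDerivAt_inverse (hXY : X t (Y t x) = x) (hYX : ∀ s, Y s (X s (Y t x)) = Y t x)
    (hY : HasFDerivAt (uncurry Y) L (t, x)) (hX : HasDerivAt (fun s => X s (Y t x)) v t) :
    HasDerivAt (fun s => Y s x) (-(L (0, v))) t := by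
  have h1 : HasDerivAt (fun s => Y s x) (L (1, 0)) t := hasDerivAt_inverse_apply_one_zero hY
  have hsum : L (1, v) = L (1, 0) + L (0, v) := by
    rw [← map_add, Prod.mk_add_mk, add_zero, zero_add]
  have h0 : L (1, 0) + L (0, v) = 0 := hsum ▸ apply_one_velocity_eq_zero hXY hYX hY hX
  rwa [eq_neg_of_add_eq_zero_left h0] at h1

/-- The space derivative of the slice `z ↦ Y_t z` is `w ↦ L (0, w)`. [folklore] -/
theorem hasFDerivAt_inverse_slice (hY : HasFDerivAt (uncurry Y) L (t, x)) :
    HasFDerivAt (fun z => Y t z) (L.comp (ContinuousLinearMap.inr ℝ ℝ E)) x :=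
  hY.comp x (hasFDerivAt_prodMk_right t x)

variable {F : E → G} {F' : E →L[ℝ] G}

/-- **Transport of a profile by the inverse flow, derivative form**: for a profile `F`
differentiable at `Y_t x`, `s ↦ F (Y_s x)` has derivative `-F'(D_x Y_t(x)[Ẋ_t(Y_t x)])` at `t`
(ACM 2019, §7: `ρ(t,x) := ρ̄(z)`, `x = Φ(t,z)`, solves `∂ₜρ + w·∇ρ = 0`).
[cite: AlbertiCrippaMazzucato2019, §7 (remark before Prop. 21)] -/
theorem hasDerivAt_comp_inverse (hXY : X t (Y t x) = x) (hYX : ∀ s, Y s (X s (Y t x)) = Y t x)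
    (hY : HasFDerivAt (uncurry Y) L (t, x)) (hX : HasDerivAt (fun s => X s (Y t x)) v t)
    (hF : HasFDerivAt F F' (Y t x)) :
    HasDerivAt (fun s => F (Y s x)) (-(F' (L (0, v)))) t := by
  have h := hF.comp_hasDerivAt t (hasDerivAt_inverse hXY hYX hY hX)
  simpa only [map_neg, Function.comp_def] using h

/-- The space derivative of the transported profile `z ↦ F (Y_t z)`. [folklore] -/
theorem hasFDerivAt_comp_inverse_slice (hY : HasFDerivAt (uncurry Y) L (t, x))
    (hF : HasFDerivAt F F' (Y t x)) :
    HasFDerivAt (fun z => F (Y t z)) (F'.comp (L.comp (ContinuousLinearMap.inr ℝ ℝ E))) x :=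
  hF.comp x (hasFDerivAt_inverse_slice hY)

/-- **The transport equation for `F ∘ Y_t`** (pointwise hypotheses):
`∂ₜ (F ∘ Y_t)(x) + D(F ∘ Y_t)(x)[Ẋ_t(Y_t x)] = 0` (ACM 2019, §7, remark before Prop. 21).
[cite: AlbertiCrippaMazzucato2019, §7 (remark before Prop. 21)] -/
theorem deriv_comp_add_fderiv_comp_apply_eq_zero (hXY : X t (Y t x) = x)
    (hYX : ∀ s, Y s (X s (Y t x)) = Y t x) (hY : HasFDerivAt (uncurry Y) L (t, x))
    (hX : HasDerivAt (fun s => X s (Y t x)) v t) (hF : HasFDerivAt F F' (Y t x)) :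
    deriv (fun s => F (Y s x)) t + fderiv ℝ (fun z => F (Y t z)) x v = 0 := by
  rw [(hasDerivAt_comp_inverse hXY hYX hY hX hF).deriv, (hasFDerivAt_comp_inverse_slice hY hF).fderiv]
  simp

end Pointwise

/-! ## The Eulerian velocity of a pair of mutually inverse time-dependent maps -/

/-- The **Eulerian velocity** of the time-dependent map `X` read through its inverse `Y`:
`V(t, x) = Ẋ_t (Y_t x)` (ACM 2019, §7: `w(t,x) := ∂ₜΦ(t,z)` with `x = Φ(t,z)`).
[cite: AlbertiCrippaMazzucato2019, §7 (remark before Prop. 21)] -/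
def eulerVelocity (X Y : ℝ → E → E) (t : ℝ) (x : E) : E :=
  deriv (fun s => X s (Y t x)) t

/-- Unfolding `eulerVelocity`. [folklore] -/
theorem eulerVelocity_apply (X Y : ℝ → E → E) (t : ℝ) (x : E) :
    eulerVelocity X Y t x = deriv (fun s => X s (Y t x)) t := rfl

/-- **Lagrangian reading**: at a transported point, `V(t, X_t z) = Ẋ_t z`. [folklore] -/
theorem eulerVelocity_apply_self {X Y : ℝ → E → E} (hYX : ∀ t z, Y t (X t z) = z) (t : ℝ) (z : E) :
    eulerVelocity X Y t (X t z) = deriv (fun s => X s z) t := by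
  rw [eulerVelocity_apply, hYX]

/-- The Eulerian velocity through the space–time derivative of `X`:
`V(t,x) = D(X)(t, Y_t x)(1, 0)`. [folklore] -/
theorem eulerVelocity_eq_fderiv {X Y : ℝ → E → E} {t : ℝ} {x : E}
    (hX : DifferentiableAt ℝ (uncurry X) (t, Y t x)) :
    eulerVelocity X Y t x = fderiv ℝ (uncurry X) (t, Y t x) (1, 0) := by
  have hι : HasDerivAt (fun s : ℝ => (s, Y t x)) (1, 0) t :=
    (hasDerivAt_id t).prodMk (hasDerivAt_const t (Y t x))
  exact (hX.hasFDerivAt.comp_hasDerivAt t hι).deriv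

/-- **Joint smoothness of the Eulerian velocity** when `X` and `Y` are jointly smooth (ACM 2019,
§7: "`w` is of class `C^{k-1}`"; here `k = ∞`). [cite: AlbertiCrippaMazzucato2019, §7 (remark before Prop. 21)] -/
theorem contDiff_eulerVelocity {X Y : ℝ → E → E} (hX : ContDiff ℝ ∞ (uncurry X))
    (hY : ContDiff ℝ ∞ (uncurry Y)) : ContDiff ℝ ∞ (uncurry (eulerVelocity X Y)) := by
  have h1 : ContDiff ℝ ∞ (fderiv ℝ (uncurry X)) := (contDiff_infty_iff_fderiv.1 hX).2
  have h2 : ContDiff ℝ ∞ (fun p : ℝ × E => (p.1, Y p.1 p.2)) := contDiff_fst.prodMk hY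
  have h3 : ContDiff ℝ ∞ (fun p : ℝ × E => fderiv ℝ (uncurry X) (p.1, Y p.1 p.2) ((1 : ℝ), (0 : E))) :=
    (h1.comp h2).clm_apply contDiff_const
  have hfun : uncurry (eulerVelocity X Y) =
      fun p : ℝ × E => fderiv ℝ (uncurry X) (p.1, Y p.1 p.2) ((1 : ℝ), (0 : E)) := by
    funext p
    exact eulerVelocity_eq_fderiv (hX.differentiable (by simp)).differentiableAt
  rw [hfun]
  exact h3

/-- Joint smoothness of the transported profile `(t, x) ↦ F (Y_t x)`. [folklore] -/
theorem contDiff_comp_inverse {Y : ℝ → E → E} {F : E → G} {n : WithTop ℕ∞}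
    (hY : ContDiff ℝ n (uncurry Y)) (hF : ContDiff ℝ n F) :
    ContDiff ℝ n (uncurry fun t x => F (Y t x)) :=
  hF.comp hY

/-- A pair of **mutually inverse time-dependent maps** `X_t`, `Y_t = X_t⁻¹` of `E` with the
differentiability the transport identity consumes: `Y` jointly differentiable and differentiable
trajectories `s ↦ X_s z` (ACM 2019, §7: `Φ(t,·)` a `C^k` flow of diffeomorphisms; only this much
is needed for the transport half of their remark). [cite: AlbertiCrippaMazzucato2019, §7 (remark before Prop. 21)] -/
structure IsInversePair (X Y : ℝ → E → E) : Prop where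
  /-- `Y_t` is a left inverse of `X_t`. -/
  left_inv : ∀ t z, Y t (X t z) = z
  /-- `Y_t` is a right inverse of `X_t`. -/
  right_inv : ∀ t x, X t (Y t x) = x
  /-- `(t, x) ↦ Y_t x` is differentiable. -/
  differentiable_uncurry : Differentiable ℝ (uncurry Y)
  /-- every trajectory `s ↦ X_s z` is differentiable. -/
  differentiable_traj : ∀ z, Differentiable ℝ fun s => X s z

namespace IsInversePair

variable {X Y : ℝ → E → E}

/-- Jointly `Cⁿ` maps, `n ≠ 0`, with two-sided inverse relations form an inverse pair. [folklore] -/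
theorem of_contDiff {n : WithTop ℕ∞} (hn : n ≠ 0) (hX : ContDiff ℝ n (uncurry X))
    (hY : ContDiff ℝ n (uncurry Y)) (hYX : ∀ t z, Y t (X t z) = z) (hXY : ∀ t x, X t (Y t x) = x) :
    IsInversePair X Y where
  left_inv := hYX
  right_inv := hXY
  differentiable_uncurry := hY.differentiable hn
  differentiable_traj z := by
    have h : Differentiable ℝ (uncurry X ∘ fun s : ℝ => (s, z)) :=
      (hX.differentiable hn).comp (differentiable_id.prodMk (differentiable_const z))
    exact h

/-- **Time derivative of the inverse**: `∂ₜ Y_t(x) = -D(Y_t)(x)[V(t,x)]`. [cite: AlbertiCrippaMazzucato2019, §7 (remark before Prop. 21)] -/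
theorem hasDerivAt_inv (h : IsInversePair X Y) (t : ℝ) (x : E) :
    HasDerivAt (fun s => Y s x) (-(fderiv ℝ (fun z => Y t z) x (eulerVelocity X Y t x))) t := by
  have hY := (h.differentiable_uncurry (t, x)).hasFDerivAt
  have hX := ((h.differentiable_traj (Y t x)) t).hasDerivAt
  have hd := hasDerivAt_inverse (h.right_inv t x) (fun s => h.left_inv s _) hY hX
  rwa [(hasFDerivAt_inverse_slice hY).fderiv]

/-- **Transport equation** (ACM 2019, §7, remark before Prop. 21): for every differentiable
profile `F`, the function `Θ(t, x) := F (Y_t x)` satisfies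
`∂ₜΘ(t,x) + DΘ_t(x)[V(t,x)] = 0` at every `(t, x)`, with `V = eulerVelocity X Y`.
[cite: AlbertiCrippaMazzucato2019, §7 (remark before Prop. 21)] -/
theorem transport (h : IsInversePair X Y) {F : E → G} (hF : Differentiable ℝ F) (t : ℝ) (x : E) :
    deriv (fun s => F (Y s x)) t + fderiv ℝ (fun z => F (Y t z)) x (eulerVelocity X Y t x) = 0 :=
  deriv_comp_add_fderiv_comp_apply_eq_zero (h.right_inv t x) (fun s => h.left_inv s _)
    (h.differentiable_uncurry (t, x)).hasFDerivAt ((h.differentiable_traj (Y t x)) t).hasDerivAt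
    (hF (Y t x)).hasFDerivAt

/-- The inverse itself is transported: `∂ₜ Y_t(x) + D(Y_t)(x)[V(t,x)] = 0`. [folklore] -/
theorem transport_self (h : IsInversePair X Y) (t : ℝ) (x : E) :
    deriv (fun s => Y s x) t + fderiv ℝ (fun z => Y t z) x (eulerVelocity X Y t x) = 0 := by
  simpa using h.transport differentiable_id t x

end IsInversePair

end InverseFlow

end Literature.Analysis.FluidPDE
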